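import Summits.HodgeConjecture.HodgeConjecture.Theorems.Ring2HypothesesDescentMotivatedWeilForm
import Summits.HodgeConjecture.HodgeConjecture.Theorems.Ring2HypothesesDescentMotivatedNumerical
import Literature.AlgebraicGeometry.HodgeTheory.ComplexGysinCorrespondence
import Literature.AlgebraicGeometry.HodgeTheory.ComplexGysinHodgeType
import Literature.AlgebraicGeometry.HodgeTheory.AlgebraicClassesHodgeTypeHolds
import HarnessLib

/-!
# Ring 2 hypotheses, descent face — André's Prop. 3.3, LAST CLAUSE, on the real carriers: the transposition
# involution of motivated (and algebraic) endo-correspondences is POSITIVE — `Tr([u]_* ∘ [u]_*') ≥ 0`, with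
# equality only for `[u]_* = 0` (Kleiman 1968, 3.11; Serre 1960, Théorème 2), unconditionally

research route conditional on HC_CM; not a corollary; Q11.4-sentence-2 already refuted in dim ≥ 3.
Cell `pub-hodge-ring2` (Hodge ladder STAGE 3), seat `ring2-b05` (binder row b05
`Ring2.Hypotheses.MotivatedImpliesAlgebraicAV`), gen 39, part 2 of 2 (part 1: `…MotivatedWeilForm`). `HC_CM`
(`Theses.RankFourFaces.CMAbelianHodge`) does not occur in this file; nothing here proves a case of the Hodge
conjecture; the row b05 stays OPEN.

André 1996, Prop. 3.3 (p. 21): «Supposons que `K` soit de caractéristique nulle et que `H` soit une cohomologie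
classique … La `ℚ`-algèbre `C⁰_mot(X, X)` est semi-simple de dimension finie. De plus, la forme bilinéaire
symétrique sur `C⁰_mot(X, X)` donnée par `(u, v) ↦ Tr(u ∘ *_H ᵗv *_H)` est à valeurs dans `ℚ`, et définie positive.
Preuve. … Le théorème de l'indice de Hodge entraîne que `(x, y) ↦ ⟨x ∪ *_H y⟩` définit un produit scalaire sur les
cycles motivés … La dernière assertion résulte aussi du théorème de l'indice de Hodge, cf. [Kl68], 3.11.» The map
`v ↦ v' = *_H ᵗv *_H` is the ADJUNCTION for the form `(x, y) ↦ ⟨x ∪ *_H y⟩` («la transposition relative à la forme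
bilinéaire `(x, y) ↦ ⟨x ∪ * y⟩`», Prop. 1.2, p. 11; `L`, `*_L`, `*_H` are self-adjoint for Poincaré duality).
Gens 36–38 of this seat proved the other clauses of Prop. 3.3 on the real carriers (hom `≡` num on `A_mot`,
semisimplicity via the trace formula and Jannsen's argument); this file proves the LAST one, per degree `a`, with
`ℂ`-coefficients (F-ref2-83), for the tree's polarisation form `Q_D` of a Kähler–rational datum (whose star is `± *_L`
on each Lefschetz component — Prop. 2.2 Cor. 1 and §1.1 Remarque: «cet opérateur star et `*_H` ont les mêmes
propriétés de positivité sur les cycles réels de type `(p,p)`»), using part 1's Serre Théorème 2 on `Hᵃ(X(ℂ); ℂ)`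
(`exists_trace_comp_eq_of_typePiece_of_cform_adjoint`: Weil's hermitian form + Hilbert–Schmidt):

* §3 `corrAction_isOfHodgeType` (a correspondence by a class of type `(e, e)` shifts Hodge types by
  `(e − dim X, e − dim X)` for EVERY orientation family, hypothesis-free form of
  `NikulinSerreCarrier.NeronSeveriIntertwiner.isOfHodgeType_corrAction` / `RelativesTate.isOfHodgeType_corrAction`;
  Voisin I §7.3.2), `corrAction_mem_typePiece_of_isOfHodgeType` (a type-`(n, n)` endo-correspondence preserves the
  type pieces); motivated classes are of type `(p, p)` by the tree's `isOfHodgeType_of_mem_motivatedClasses`.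
* §4 **ANDRÉ PROP. 3.3 (last clause) / KLEIMAN 3.11 ON THE REAL CARRIERS**:
  `exists_trace_corrAction_comp_eq_of_isOfHodgeType` (any orientation family `μ`, any `u ∈ H^{2n}((X ⊗ X)(ℂ))` of
  type `(n, n)`, `T'` the `Q_D`-adjoint of `conj [u]_* conj`: `Tr([u]_* ∘ T')` real `≥ 0`, `= 0` iff `[u]_* = 0`),
  **`…_of_mem_motivatedClasses`** (MOTIVATED `u`), `…_of_mem_algebraicClasses` (ALGEBRAIC `u`, Kleiman's statement);
  for the complex orientation family the printed shapes `…_of_isAdjointPair_conj` (`T'` the `Q_D`-adjoint of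
  `[conj u]_*`) and **`exists_trace_corrAction_comp_eq_of_isAdjointPair_of_conjClass_eq`** (REAL — e.g. rational —
  motivated `u`: `T'` the `Q_D`-adjoint of `[u]_*` ITSELF, André's `u'`); `not_isNilpotent_corrAction_comp_of_ne_zero`
  (André's own route to Prop. 3.1/3.3: a non-zero motivated operator generates no nil ideal, `[u]_* ∘ [u]_*'` having
  positive trace).

No definition, no named fact, no sorry. References: Andre1996Motifs (Prop. 3.3 pp. 21–22, Prop. 1.2 p. 11, §1.1
Remarque p. 11, Prop. 2.2 Cor. 1 p. 16, §2.5 c)), Kleiman1968AlgebraicCycles (§3, 3.11), Serre1960Kahler (Thm. 2,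
pp. 393–394), VoisinHodgeI2002 (§6.3.2 Thm. 6.32, §7.1.2, Cor. 6.12, §7.3.2).
-/

noncomputable section

-- every declaration of this problem lives in `Summit.HodgeConjecture.HodgeConjecture.…` (summit = sub-problem)
set_option linter.dupNamespace false

open CategoryTheory AlgebraicGeometry MonoidalCategory CartesianMonoidalCategory
open Literature.AlgebraicTopology.SingularHomology Literature.Geometry.Kaehler
open Literature.AlgebraicGeometry Literature.AlgebraicGeometry.Motives
  Literature.AlgebraicGeometry.HodgeTheory
open Summit.HodgeConjecture.HodgeConjecture.Theorems.LefschetzStandardB (conjClass_corrAction)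
open scoped ComplexOrder

namespace Summit.HodgeConjecture.HodgeConjecture.Theorems

variable {n : ℕ} {X : SchemeOver ℂ}

/-! ## §3 Correspondences by classes of type `(e, e)` — in particular motivated ones — preserve Hodge types -/

section TypeShift

variable {m : ℕ} {W : SchemeOver ℂ}

/-- **A correspondence by a class of type `(e, e)` shifts Hodge types by `(e − n, e − n)`** (`n = dim X`): for
`γ ∈ H^{2e}((W ⊗ X)(ℂ); ℂ)` of type `(e, e)` and `c ∈ Hᵃ(X(ℂ); ℂ)` of type `(p, q)`, the class
`[γ]_* c = pr_{W*}(pr_X^* c ∪ γ) ∈ Hᵇ(W(ℂ); ℂ)` (`corrAction μ`, any orientation family) is of type `(p', q')` with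
`p' + n = p + e`, `q' + n = q + e` (pull-back preserves types, cup product adds them, the Gysin morphism of `pr_W`
lowers them by `(n, n)` — Voisin I §7.3.2, the tree's `isOfHodgeType_complexGysin` fed with the discharged
`hodgePQ_independent_of_hodgeModel_holds`, `nonempty_hodgeModel_holds`, `exists_deRhamIsoFamily_holds`); the
hypothesis-free form, for every orientation family, of `NikulinSerreCarrier.NeronSeveriIntertwiner.isOfHodgeType_corrAction`.
[cite: VoisinHodgeI2002, §7.3.2 (with Lemma 7.30) and §7.1.2] -/
theorem corrAction_isOfHodgeType (μ : OrientationFamily) (hW : IsSmoothProjective m W) (hX : IsSmoothProjective n X)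
    {e a b : ℕ} (hab : a + 2 * e = b + 2 * n) {γ : complexBetti (W ⊗ X) (2 * e)}
    (hγ : IsOfHodgeType (m + n) (W ⊗ X) (2 * e) e e γ) {p q p' q' : ℕ} (hp : p' + n = p + e) (hq : q' + n = q + e)
    {c : complexBetti X a} (hc : IsOfHodgeType n X a p q c) :
    IsOfHodgeType m W b p' q' (corrAction μ hW hX hab γ c) := by
  have hI := hodgePQ_independent_of_hodgeModel_holds
  have hWX := hW.tensor_holds hX
  obtain ⟨C⟩ := (nonempty_hodgeModel_holds (n := m + n) (X := W ⊗ X)).nonempty hWX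
  have hfc : IsOfHodgeType (m + n) (W ⊗ X) a p q (complexBetti.map (snd W X) a c) :=
    IsOfHodgeType.map_of_independent hI hc hWX hX C (snd W X)
  have hcup : IsOfHodgeType (m + n) (W ⊗ X) (a + 2 * e) (p + e) (q + e)
      (cupProduct rfl (complexBetti.map (snd W X) a c) γ) :=
    cupPreservesHodgeType_of_hodgeModel hWX C rfl hfc hγ
  rw [corrAction_apply]
  exact isOfHodgeType_complexGysin hI (fun _ _ ↦ nonempty_hodgeModel_holds)
    (fun E _ _ _ ↦ Literature.NumberTheory.Transcendental.exists_deRhamIsoFamily_holds E) μ hWX hW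
    (fst W X) (corrAction_degree m hab) (by omega) (by omega) hcup

end TypeShift

/-- **An endo-correspondence by a class of type `(n, n)` preserves every Hodge type piece of `Hᵃ(X(ℂ); ℂ)`**
(`corrAction_isOfHodgeType` with `e = n = dim X`). [cite: VoisinHodgeI2002, §7.3.2] -/
theorem corrAction_mem_typePiece_of_isOfHodgeType (μ : OrientationFamily) (hX : IsSmoothProjective n X)
    (A : HodgeModel n X) {a : ℕ} {u : complexBetti (X ⊗ X) (2 * n)}
    (hu : IsOfHodgeType (n + n) (X ⊗ X) (2 * n) n n u) (pq : ↥(Finset.HasAntidiagonal.antidiagonal a))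
    {x : complexBetti X a} (hx : x ∈ A.typePiece a pq) :
    corrAction μ hX hX (rfl : a + 2 * n = a + 2 * n) u x ∈ A.typePiece a pq := by
  obtain ⟨⟨p, q⟩, hpq⟩ := pq
  have hx' : IsOfHodgeType n X a p q x := ⟨A, hx⟩
  have h := corrAction_isOfHodgeType μ hX hX (rfl : a + 2 * n = a + 2 * n) hu (p' := p) (q' := q)
    (by omega) (by omega) hx'
  exact A.mem_typePiece_of_isOfHodgeType hodgePQ_independent_of_hodgeModel_holds hX hpq h

/-! ## §4 André's Prop. 3.3, last clause (Kleiman 3.11): the transposition involution is positive -/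

/-- **POSITIVITY OF THE TRANSPOSITION INVOLUTION FOR CORRESPONDENCES OF TYPE `(n, n)`** (any orientation family
`μ`). For `X` smooth projective of dimension `n`, a Kähler–rational datum `D`, a degree `a`, a class
`u ∈ H^{2n}((X ⊗ X)(ℂ); ℂ)` of Hodge type `(n, n)` with operator `T = [u]_* : Hᵃ(X(ℂ); ℂ) → Hᵃ(X(ℂ); ℂ)`, and `T'`
the `Q_D`-adjoint of `conj ∘ T ∘ conj` (`Q_D(T' x, y) = Q_D(x, conj T conj y)`; it exists uniquely,
`exists_unique_cform_adjoint_conj`): `Tr(T ∘ T')` is a non-negative real number, `= 0` iff `T = 0`.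
[cite: Andre1996Motifs, Prop. 3.3 (pp. 21–22)] [cite: Kleiman1968AlgebraicCycles, §3, 3.11]
[cite: Serre1960Kahler, Thm 2, pp. 393–394] -/
theorem exists_trace_corrAction_comp_eq_of_isOfHodgeType (μ : OrientationFamily) (hX : IsSmoothProjective n X)
    (D : KaehlerRationalDatum n X) (a : ℕ) {u : complexBetti (X ⊗ X) (2 * n)}
    (hu : IsOfHodgeType (n + n) (X ⊗ X) (2 * n) n n u) {T' : complexBetti X a →ₗ[ℂ] complexBetti X a}
    (hT' : ∀ x y, D.cform hX a (T' x) y = D.cform hX a x (conjClass (ComplexPoints X) a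
      (corrAction μ hX hX (rfl : a + 2 * n = a + 2 * n) u (conjClass (ComplexPoints X) a y)))) :
    ∃ r : ℝ, 0 ≤ r ∧ LinearMap.trace ℂ _ (corrAction μ hX hX (rfl : a + 2 * n = a + 2 * n) u ∘ₗ T') = r ∧
      (r = 0 ↔ corrAction μ hX hX (rfl : a + 2 * n = a + 2 * n) u = 0) := by
  obtain ⟨A⟩ := nonempty_hodgeModel_holds hX
  exact exists_trace_comp_eq_of_typePiece_of_cform_adjoint hX D A
    (fun pq x hx ↦ corrAction_mem_typePiece_of_isOfHodgeType μ hX A hu pq hx) hT'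

/-- **ANDRÉ 1996, PROP. 3.3, LAST CLAUSE, ON THE REAL CARRIERS — MOTIVATED CORRESPONDENCES.** For `X` smooth
projective of dimension `n`, a Kähler–rational datum `D`, a degree `a`, an orientation family `μ`, a MOTIVATED
`u ∈ A_motⁿ(X ⊗ X)_ℂ` with operator `T = [u]_*` on `Hᵃ(X(ℂ); ℂ)`, and `T'` the `Q_D`-adjoint of `conj ∘ T ∘ conj`:
`Tr(T ∘ T') ≥ 0` (a real number), with equality iff `T = 0` — the positivity («définie positive») of André's form
`(u, v) ↦ Tr(u ∘ v')` on the degree-`a` component of `C⁰_mot(X, X)`, UNCONDITIONALLY (motivated classes are of type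
`(n, n)`). [cite: Andre1996Motifs, Prop. 3.3 (pp. 21–22) and §1.1 Remarque (p. 11)]
[cite: Kleiman1968AlgebraicCycles, §3, 3.11] [cite: Serre1960Kahler, Thm 2, pp. 393–394] -/
theorem exists_trace_corrAction_comp_eq_of_mem_motivatedClasses (μ : OrientationFamily) (hX : IsSmoothProjective n X)
    (D : KaehlerRationalDatum n X) (a : ℕ) {u : complexBetti (X ⊗ X) (2 * n)}
    (hu : u ∈ motivatedClasses (n + n) (X ⊗ X) n) {T' : complexBetti X a →ₗ[ℂ] complexBetti X a}
    (hT' : ∀ x y, D.cform hX a (T' x) y = D.cform hX a x (conjClass (ComplexPoints X) a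
      (corrAction μ hX hX (rfl : a + 2 * n = a + 2 * n) u (conjClass (ComplexPoints X) a y)))) :
    ∃ r : ℝ, 0 ≤ r ∧ LinearMap.trace ℂ _ (corrAction μ hX hX (rfl : a + 2 * n = a + 2 * n) u ∘ₗ T') = r ∧
      (r = 0 ↔ corrAction μ hX hX (rfl : a + 2 * n = a + 2 * n) u = 0) :=
  exists_trace_corrAction_comp_eq_of_isOfHodgeType μ hX D a
    (isOfHodgeType_of_mem_motivatedClasses (hX.tensor_holds hX) hu) hT'

/-- **KLEIMAN 1968, 3.11, ON THE REAL CARRIERS — ALGEBRAIC CORRESPONDENCES**: the same for an ALGEBRAIC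
`u ∈ Nⁿ H^{2n}((X ⊗ X)(ℂ); ℂ) = algebraicClasses (X ⊗ X) n` (algebraic classes are of type `(n, n)`, the tree's
`isOfHodgeType_of_mem_algebraicClasses_of_isSmoothProjective`). [cite: Kleiman1968AlgebraicCycles, §3, 3.11]
[cite: Andre1996Motifs, Prop. 3.3 (pp. 21–22)] -/
theorem exists_trace_corrAction_comp_eq_of_mem_algebraicClasses (μ : OrientationFamily) (hX : IsSmoothProjective n X)
    (D : KaehlerRationalDatum n X) (a : ℕ) {u : complexBetti (X ⊗ X) (2 * n)}
    (hu : u ∈ algebraicClasses (X ⊗ X) n) {T' : complexBetti X a →ₗ[ℂ] complexBetti X a}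
    (hT' : ∀ x y, D.cform hX a (T' x) y = D.cform hX a x (conjClass (ComplexPoints X) a
      (corrAction μ hX hX (rfl : a + 2 * n = a + 2 * n) u (conjClass (ComplexPoints X) a y)))) :
    ∃ r : ℝ, 0 ≤ r ∧ LinearMap.trace ℂ _ (corrAction μ hX hX (rfl : a + 2 * n = a + 2 * n) u ∘ₗ T') = r ∧
      (r = 0 ↔ corrAction μ hX hX (rfl : a + 2 * n = a + 2 * n) u = 0) :=
  exists_trace_corrAction_comp_eq_of_isOfHodgeType μ hX D a
    (isOfHodgeType_of_mem_algebraicClasses_of_isSmoothProjective (hX.tensor_holds hX) n hu) hT'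

/-- **For the complex orientation family: `T'` the `Q_D`-adjoint of `[conj u]_*`.** With the complex orientations
`conj ∘ [u]_* ∘ conj = [conj u]_*` (`LefschetzStandardB.conjClass_corrAction`), so the hypothesis reads
`Q_D(T' x, y) = Q_D(x, [conj u]_* y)` (`LinearMap.IsAdjointPair`). [cite: Andre1996Motifs, Prop. 3.3 (pp. 21–22)]
[cite: VoisinHodgeI2002, Cor. 6.12 and §7.3.2] -/
theorem exists_trace_corrAction_comp_eq_of_isAdjointPair_conj (hX : IsSmoothProjective n X)
    (D : KaehlerRationalDatum n X) (a : ℕ) {u : complexBetti (X ⊗ X) (2 * n)}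
    (hu : IsOfHodgeType (n + n) (X ⊗ X) (2 * n) n n u) {T' : complexBetti X a →ₗ[ℂ] complexBetti X a}
    (hT' : LinearMap.IsAdjointPair (D.cform hX a) (D.cform hX a) T'
      (corrAction complexOrientationFamily hX hX (rfl : a + 2 * n = a + 2 * n)
        (conjClass (ComplexPoints (X ⊗ X)) (2 * n) u))) :
    ∃ r : ℝ, 0 ≤ r ∧
      LinearMap.trace ℂ _ (corrAction complexOrientationFamily hX hX (rfl : a + 2 * n = a + 2 * n) u ∘ₗ T') = r ∧
      (r = 0 ↔ corrAction complexOrientationFamily hX hX (rfl : a + 2 * n = a + 2 * n) u = 0) :=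
  exists_trace_corrAction_comp_eq_of_isOfHodgeType complexOrientationFamily hX D a hu fun x y ↦ by
    rw [conjClass_corrAction hX hX rfl u, conjClass_conjClass]
    exact hT' x y

/-- **ANDRÉ'S PRINTED SHAPE — REAL MOTIVATED CORRESPONDENCES** (e.g. rational ones, André's `ℚ`-structure
`C⁰_mot(X, X)`): for a motivated `u` with `conj u = u` and the complex orientation family, if `T'` is the
`Q_D`-ADJOINT OF `T = [u]_*` ITSELF (`Q_D(T' x, y) = Q_D(x, T y)` — the transpose for `(x, y) ↦ ⟨x ∪ * y⟩`, André's
`T' = * ᵗT *`), then `Tr(T ∘ T') ≥ 0` with equality iff `T = 0`: the value `(u, u)` of André's positive definite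
form. [cite: Andre1996Motifs, Prop. 3.3 (pp. 21–22) and Prop. 1.2 (p. 11)] [cite: Kleiman1968AlgebraicCycles, §3, 3.11] -/
theorem exists_trace_corrAction_comp_eq_of_isAdjointPair_of_conjClass_eq (hX : IsSmoothProjective n X)
    (D : KaehlerRationalDatum n X) (a : ℕ) {u : complexBetti (X ⊗ X) (2 * n)}
    (hu : u ∈ motivatedClasses (n + n) (X ⊗ X) n) (hreal : conjClass (ComplexPoints (X ⊗ X)) (2 * n) u = u)
    {T' : complexBetti X a →ₗ[ℂ] complexBetti X a}
    (hT' : LinearMap.IsAdjointPair (D.cform hX a) (D.cform hX a) T'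
      (corrAction complexOrientationFamily hX hX (rfl : a + 2 * n = a + 2 * n) u)) :
    ∃ r : ℝ, 0 ≤ r ∧
      LinearMap.trace ℂ _ (corrAction complexOrientationFamily hX hX (rfl : a + 2 * n = a + 2 * n) u ∘ₗ T') = r ∧
      (r = 0 ↔ corrAction complexOrientationFamily hX hX (rfl : a + 2 * n = a + 2 * n) u = 0) :=
  exists_trace_corrAction_comp_eq_of_isAdjointPair_conj hX D a
    (isOfHodgeType_of_mem_motivatedClasses (hX.tensor_holds hX) hu) (by rwa [hreal])

/-- **André's own route to Prop. 3.1/3.3 («résulte aussi du théorème de l'indice de Hodge»)**: a NON-ZERO operator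
`T = [u]_*` of a motivated `u` on `Hᵃ(X(ℂ); ℂ)` generates no nil ideal — `T ∘ T'` is not nilpotent, since its trace is
positive (nilpotent operators have trace `0`). [cite: Andre1996Motifs, Prop. 3.3 (pp. 21–22) and Prop. 3.1 (p. 20)]
[cite: Kleiman1968AlgebraicCycles, §3, 3.11] -/
theorem not_isNilpotent_corrAction_comp_of_ne_zero (μ : OrientationFamily) (hX : IsSmoothProjective n X)
    (D : KaehlerRationalDatum n X) (a : ℕ) {u : complexBetti (X ⊗ X) (2 * n)}
    (hu : u ∈ motivatedClasses (n + n) (X ⊗ X) n) {T' : complexBetti X a →ₗ[ℂ] complexBetti X a}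
    (hT' : ∀ x y, D.cform hX a (T' x) y = D.cform hX a x (conjClass (ComplexPoints X) a
      (corrAction μ hX hX (rfl : a + 2 * n = a + 2 * n) u (conjClass (ComplexPoints X) a y))))
    (hne : corrAction μ hX hX (rfl : a + 2 * n = a + 2 * n) u ≠ 0) :
    ¬ IsNilpotent (corrAction μ hX hX (rfl : a + 2 * n = a + 2 * n) u ∘ₗ T') := by
  haveI : Module.Finite ℂ (complexBetti X a) := finite_complexBetti hX a
  intro hnil
  obtain ⟨r, -, hr, hr0⟩ := exists_trace_corrAction_comp_eq_of_mem_motivatedClasses μ hX D a hu hT'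
  have h0 := (LinearMap.isNilpotent_trace_of_isNilpotent hnil).eq_zero
  rw [hr, Complex.ofReal_eq_zero] at h0
  exact hne (hr0.1 h0)

end Summit.HodgeConjecture.HodgeConjecture.Theorems

end
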